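import Summits.HodgeConjecture.CorCM.CycleClassFacts
import Literature.AlgebraicGeometry.Motives.AbelianVarietyCohomologyExteriorH1
import Mathlib.LinearAlgebra.ExteriorPower.Basis
import Mathlib.LinearAlgebra.Charpoly.BaseChange
import HarnessLib

/-!
# COR-CM model layer, part 3a: an endomorphism of a complex abelian variety acts on top cohomology
# by the determinant of its action on `H¹` (towards `Fact_deg_diag`)

Cell `pub-hodgecm2` (COR-CM), seat `model-1`.  Stage 1's model fact `Fact_deg_diag` (`HodgeCM/Geometry/Facts.lean`
l.224, FACTS.md §1 row M27, `ModelAxioms` field 27; READ by rfwf Prop 2.2, `Proofs/Prop22/Algebraic.Bc_pull_pull`)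
says: for the product `P` of four CM abelian varieties and `M : P → P` acting diagonally by `a ∈ K`,
`tr_P ∘ M^* = N_{K/ℚ}(a)⁴ · tr_P` on every `Hᵏ(P, ℚ)`.  Its proof on the Picard–CM model has two halves:
(i) on the top cohomology of an abelian variety an endomorphism acts by the determinant of its action on
`H¹` — THIS FILE; (ii) for the diagonal action that determinant is `N(a)⁴` (Künneth in degree one, the four
`H¹(Aᵢ, ℚ)` being `K`-lines) — part 3b.

Content (all PROVED, for any `A : Motives.AbelianVariety ℂ` and any morphism of `ℂ`-schemes `φ : A.X ⟶ A.X`):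
* `exteriorPower_map_top_eq_det_smul` — linear algebra: on the top exterior power `⋀ⁿ V` of an
  `n`-dimensional vector space, `⋀ⁿ f` is multiplication by `det f` (`AlternatingMap.eq_smul_basis_det`,
  `Module.Basis.det_comp`);
* `complexBetti_map_top_eq_det_smul` — `φ^* = det(φ^*|_{H¹(A(ℂ);ℂ)}) · id` on `H^{2 dim A}(A(ℂ); ℂ)`, from
  the tree's theorem `H•(A(ℂ); ℂ) = ⋀• H¹` (`abelianVarietyCohomologyExteriorH1_holds`: `wedgeToCup` bijective and
  natural, Lange–Birkenhake Lemma 1.1.17 / Exercise 1.1.6 (7));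
* `det_complexBetti_map_one` — `det(φ^*|_{H¹(A(ℂ);ℂ)}) = det(φ^*|_{H¹(A(ℂ);ℚ)})` (the complexification
  `ℂ ⊗_ℚ H¹(ℚ) ≅ H¹(ℂ)` is natural; `LinearMap.det_baseChange`);
* `pull_top_eq_det_smul` — the RATIONAL statement `φ^* x = det(φ^*|_{H¹(A(ℂ);ℚ)}) • x` on
  `H^{2 dim A}(A(ℂ); ℚ)`, and `tr_top_comp_pull` — `tr ∘ φ^* = det • tr` for the light trace `BettiUniverse.tr`
  in every degree (`tr = 0` off the top degree).
-/

noncomputable section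

open scoped TensorProduct
open CategoryTheory
open Literature.AlgebraicTopology.SingularHomology
open Literature.AlgebraicGeometry.Motives (SchemeOver ComplexPoints IsSmoothProjective bettiCohomology AbelianVariety
  abelianVarietyCohomologyExteriorH1_holds)
open Literature.AlgebraicGeometry.HodgeTheory

namespace Summit.HodgeConjecture.CorCM.Model

/-! ### Linear algebra: the top exterior power of an endomorphism is its determinant -/

/-- **`⋀ⁿ f = det f` on the top exterior power** of an `n`-dimensional vector space (`b` a basis indexed
by `Fin n`): every linear functional of `⋀ⁿ V` composed with `v ↦ v₀ ∧ ⋯ ∧ v_{n-1}` is a multiple of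
`b.det`, and `b.det (f ∘ v) = det f · b.det v`. -/
theorem exteriorPower_map_top_eq_det_smul {K V : Type*} [Field K] [AddCommGroup V] [Module K V] {n : ℕ}
    (b : Module.Basis (Fin n) K V) (f : V →ₗ[K] V) (x : ⋀[K]^n V) :
    exteriorPower.map n f x = LinearMap.det f • x := by
  suffices h : exteriorPower.map n f = LinearMap.det f • LinearMap.id from by
    rw [h, LinearMap.smul_apply, LinearMap.id_apply]
  refine LinearMap.ext_on_range (exteriorPower.ιMulti_span K n (M := V)) fun v ↦ ?_
  rw [exteriorPower.map_apply_ιMulti, LinearMap.smul_apply, LinearMap.id_apply]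
  have key : ∀ ℓ : (⋀[K]^n V) →ₗ[K] K,
      ℓ (exteriorPower.ιMulti K n (f ∘ v)) = ℓ (LinearMap.det f • exteriorPower.ιMulti K n v) := by
    intro ℓ
    let φ : V [⋀^Fin n]→ₗ[K] K := ℓ.compAlternatingMap (exteriorPower.ιMulti K n)
    have h1 : ℓ (exteriorPower.ιMulti K n (f ∘ v)) = φ (f ∘ v) := rfl
    have h2 : ℓ (exteriorPower.ιMulti K n v) = φ v := rfl
    rw [map_smul, h1, h2, φ.eq_smul_basis_det b, AlternatingMap.smul_apply, AlternatingMap.smul_apply,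
      Module.Basis.det_comp, smul_eq_mul, smul_eq_mul, smul_eq_mul]
    ring
  exact (b.exteriorPower n).ext_elem fun s ↦ key ((b.exteriorPower n).coord s)

/-! ### Top cohomology of a complex abelian variety -/

section AbelianVariety

variable (A : AbelianVariety ℂ) (φ : A.X ⟶ A.X)

/-- **`φ^* = det(φ^*|_{H¹}) · id` on `H^{2 dim A}(A(ℂ); ℂ)`** for any endomorphism `φ` of the variety
underlying a complex abelian variety: `H^{2g} = ⋀^{2g} H¹` compatibly with pull-backs
(`abelianVarietyCohomologyExteriorH1_holds`, `complexBetti_map_wedgeToCup`), `dim H¹ = 2g`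
(`finrank_complexBetti_one`), and `exteriorPower_map_top_eq_det_smul`. -/
theorem complexBetti_map_top_eq_det_smul (x : complexBetti A.X (2 * A.dim)) :
    complexBetti.map φ (2 * A.dim) x = LinearMap.det (complexBetti.map φ 1).hom • x := by
  have h := abelianVarietyCohomologyExteriorH1_holds
  haveI := h.finite_one A
  obtain ⟨y, rfl⟩ := (h.equiv A (2 * A.dim)).surjective x
  let b : Module.Basis (Fin (2 * A.dim)) ℂ (complexBetti A.X 1) :=
    Module.finBasisOfFinrankEq ℂ (complexBetti A.X 1) (AbelianVariety.finrank_complexBetti_one A)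
  rw [h.equiv_apply, Literature.AlgebraicGeometry.Motives.complexBetti_map_wedgeToCup,
    exteriorPower_map_top_eq_det_smul b, map_smul]

/-- **`det(φ^*|_{H¹(ℂ)}) = det(φ^*|_{H¹(ℚ)})`**: the complexification is natural
(`ofRatClassBaseChange_baseChange_map`), so `φ^*|_{H¹(ℂ)}` is conjugate to the base change of
`φ^*|_{H¹(ℚ)}`, whose determinant is the image of the rational one (`LinearMap.det_baseChange`). -/
theorem det_complexBetti_map_one :
    LinearMap.det (complexBetti.map φ 1).hom = ((LinearMap.det (BettiUniverse.pull φ 1) : ℚ) : ℂ) := by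
  -- the complexification `ℂ ⊗_ℚ H¹(A(ℂ); ℚ) ≃ H¹(A(ℂ); ℂ)` (universal coefficients; bijective for smooth projective `A`)
  let β : ℂ ⊗[ℚ] bettiCohomology A.X 1 ≃ₗ[ℂ] complexBetti A.X 1 :=
    ofRatClassBaseChangeEquiv (AbelianVariety.isSmoothProjective_holds (A := A)) 1
  have hconj : (complexBetti.map φ 1).hom =
      (β : _ →ₗ[ℂ] _) ∘ₗ (BettiUniverse.pull φ 1).baseChange ℂ ∘ₗ (β.symm : _ →ₗ[ℂ] _) := by
    refine LinearMap.ext fun z ↦ ?_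
    obtain ⟨t, rfl⟩ := β.surjective z
    rw [LinearMap.comp_apply, LinearMap.comp_apply, LinearEquiv.coe_coe, LinearEquiv.coe_coe,
      β.symm_apply_apply]
    exact (HodgeModel.ofRatClassBaseChange_baseChange_map φ 1 t).symm
  rw [hconj, LinearMap.det_conj, LinearMap.det_baseChange]
  rfl

/-- **`φ^* x = det(φ^*|_{H¹(A(ℂ);ℚ)}) • x` on `H^{2 dim A}(A(ℂ); ℚ)`** (the rational statement: the rational
lattice `Hᵏ(ℚ) → Hᵏ(ℂ)` is injective and commutes with `φ^*`). -/
theorem pull_top_eq_det_smul (x : bettiCohomology A.X (2 * A.dim)) :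
    BettiUniverse.pull φ (2 * A.dim) x = LinearMap.det (BettiUniverse.pull φ 1) • x := by
  apply ofRatClass_injective (2 * A.dim)
  rw [ofRatClass_pull, complexBetti_map_top_eq_det_smul, det_complexBetti_map_one,
    Literature.AlgebraicGeometry.Motives.ofRatClass_smul]

/-- **`tr ∘ φ^* = det(φ^*|_{H¹}) • tr` in every degree** for the light trace `BettiUniverse.tr` of the
variety underlying a complex abelian variety (off the top degree both sides vanish, `BettiUniverse.tr_of_ne`). -/
theorem tr_comp_pull_eq_det_smul (k : ℕ) :
    BettiUniverse.tr (AbelianVariety.isSmoothProjective_holds (A := A)) k ∘ₗ BettiUniverse.pull φ k =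
      LinearMap.det (BettiUniverse.pull φ 1) •
        BettiUniverse.tr (AbelianVariety.isSmoothProjective_holds (A := A)) k := by
  by_cases hk : k = 2 * A.dim
  · subst hk
    refine LinearMap.ext fun x ↦ ?_
    rw [LinearMap.comp_apply, pull_top_eq_det_smul, LinearMap.map_smul, LinearMap.smul_apply]
  · rw [BettiUniverse.tr_of_ne _ hk, LinearMap.zero_comp, smul_zero]

end AbelianVariety

end Summit.HodgeConjecture.CorCM.Model

end
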